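import Summits.QuantumAdvantage.QuantumAdvantage.Theorems.LinnikCubicClassGroupsDegreeOnePrimesEscapePerCharacterDeficitSmoothedBound
import Literature.NumberTheory.LFunctions.ClassGroupExplicitFormulaBounds
import HarnessLib

/-!
# Auxiliary estimates for the one-sided lower prime ideal theorem (T5): the Landau–Page region in
# `Q`-form, the trivial zero and the left line for `ζ₁_K`, and the numerics of the exceptional term

Topic `Summits/QuantumAdvantage/QuantumAdvantage/Theorems`, helper for the stub
`stub_lowerPIT_of_density` (T5 of line `subgroup-orthogonality-escape`, crux `DegreeOnePrimesEscape`,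
stmt-QuantumAdvantage-11543); cell B2b-1 (linnik-cubic), PART A.  HONEST FRAMING: the value of this
file is a THEOREM (kernel-checked lemmas) — not summit progress.

* `lpRegion_of_not_good` — a zero outside `β ≤ 1 − c/(a log Q + log(|γ|+4))` (`0 < c ≤ c₀`, `a ≥ 1`) lies in
  the Landau–Page region `β > 1 − c₀/(log|d_K| + log(|γ|+4))`;
* `trivialZero_term_le_one`, `leftLine_term_le_one` — the `ζ₁_K` twins of the sibling's
  `trivialZero_term_le` / `leftLine_term_le` (`m₀(L+ε) ≤ 1152 e^{L/4}`, `‖J₁(0)‖ ≤ 8·leftLineConst·Al(n+1)M`),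
  from `analyticOrderNatAt_dedekindZeta₁_zero_le` and `norm_dzEFRemainder_tzTest_zero_le`;
* `exp_four_ge`, `exp_six_ge`, `integral_exp_mul_le_div` — `∫_{L/2}^{L} e^{βu} du ≤ e^L/50` for
  `β ≥ 15/16`, `(1 − β)L ≥ 4`.
-/

noncomputable section

open Complex Real MeasureTheory Set Filter Topology
open scoped NumberField nonZeroDivisors
open Literature.NumberTheory.LFunctions Literature.NumberTheory.LFunctions.NumberField
  Literature.NumberTheory.LFunctions.EntireEF Literature.NumberTheory.LFunctions.TZWeight

namespace Summit.QuantumAdvantage.QuantumAdvantage.Theorems.DegreeOnePrimesEscape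

/-! ### The Landau–Page region contains the complement of the `Q`-form zero-free region -/

/-- If `Re ρ > 1 − c/(a log Q + log(|γ| + 4))` with `0 < c ≤ c₀`, `a ≥ 1`, then
`Re ρ > 1 − c₀/(log|d_K| + log(|γ| + 4))` (`log|d_K| ≤ log Q ≤ a log Q`). -/
theorem lpRegion_of_not_good (K : Type) [Field K] [NumberField K] (hK : 1 < Module.finrank ℚ K)
    {c c₀ a : ℝ} (hc : 0 < c) (hcc₀ : c ≤ c₀) (ha : 1 ≤ a) {ρ : ℂ}
    (hρ : ¬ ρ.re ≤ 1 - c / (a * Real.log (ThornerZaman.condQn K) + Real.log (|ρ.im| + 4))) :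
    1 - c₀ / (Real.log ((NumberField.discr K).natAbs : ℝ) + Real.log (|ρ.im| + 4)) < ρ.re := by
  rw [not_le] at hρ
  have hQ12 : (12 : ℝ) ≤ ThornerZaman.condQn K := ThornerZaman.twelve_le_condQn (K := K) hK
  have hlog4 : 0 < Real.log (|ρ.im| + 4) := Real.log_pos (by linarith [abs_nonneg ρ.im])
  obtain ⟨hlogd, -⟩ := log_natAbs_discr_mem K
  have hd0 : (0 : ℝ) < ((NumberField.discr K).natAbs : ℝ) := by
    exact_mod_cast Nat.pos_of_ne_zero (Int.natAbs_ne_zero.2 (NumberField.discr_ne_zero K))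
  have hlogdQ : Real.log ((NumberField.discr K).natAbs : ℝ) ≤ a * Real.log (ThornerZaman.condQn K) := by
    have h1 := Real.log_le_log hd0 (natAbs_discr_le_condQn K)
    have h2 : 0 ≤ Real.log (ThornerZaman.condQn K) := Real.log_nonneg (by linarith)
    nlinarith
  have h2 : c / (a * Real.log (ThornerZaman.condQn K) + Real.log (|ρ.im| + 4)) ≤
      c / (Real.log ((NumberField.discr K).natAbs : ℝ) + Real.log (|ρ.im| + 4)) :=
    div_le_div_of_nonneg_left hc.le (by linarith) (by linarith)
  have h3 : c / (Real.log ((NumberField.discr K).natAbs : ℝ) + Real.log (|ρ.im| + 4)) ≤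
      c₀ / (Real.log ((NumberField.discr K).natAbs : ℝ) + Real.log (|ρ.im| + 4)) :=
    div_le_div_of_nonneg_right hcc₀ (by linarith)
  linarith

/-! ### The trivial zero and the left line for `ζ₁_K` -/

/-- The trivial zero: `m₀ (L + ε) ≤ 1152 e^{L/4}` for `ζ₁_K`, `K` of degree `n > 1`, `Q ≤ e^{L/8}`,
`0 ≤ ε ≤ 1 ≤ L` (`m₀ ≤ 8(log|d_K| + 6n + 3) ≤ 72 Q`, `L ≤ 8e^{L/8}`). -/
theorem trivialZero_term_le_one (K : Type) [Field K] [NumberField K] (hK : 1 < Module.finrank ℚ K)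
    {L ε : ℝ} (hL : 1 ≤ L) (hε0 : 0 ≤ ε) (hε1 : ε ≤ 1)
    (hQexp : ThornerZaman.condQn K ≤ Real.exp (L / 8)) :
    (analyticOrderNatAt (dedekindZeta₁ K) 0 : ℝ) * (L + ε) ≤ 1152 * Real.exp (L / 4) := by
  set Q := ThornerZaman.condQn K with hQ
  have hQ12 : (12 : ℝ) ≤ Q := ThornerZaman.twelve_le_condQn (K := K) hK
  have hm₀ := analyticOrderNatAt_dedekindZeta₁_zero_le (K := K)
  obtain ⟨-, hlogd⟩ := log_natAbs_discr_mem K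
  have hnQ : (Module.finrank ℚ K : ℝ) ≤ Q := ThornerZaman.finrank_le_condQn (K := K)
  have h1 : 8 * (Real.log ((NumberField.discr K).natAbs : ℝ) + 6 * Module.finrank ℚ K + 3) ≤ 72 * Q := by
    rw [← hQ] at hlogd; linarith
  have h2 : L + ε ≤ 2 * L := by linarith
  have h3 : (analyticOrderNatAt (dedekindZeta₁ K) 0 : ℝ) * (L + ε) ≤ 72 * Q * (2 * L) :=
    mul_le_mul (hm₀.trans h1) h2 (by linarith) (by positivity)
  have hL8 := le_eight_mul_exp_div L
  have hee : Real.exp (L / 8) * Real.exp (L / 8) = Real.exp (L / 4) := by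
    rw [← Real.exp_add]; ring_nf
  have h4 : Q * L ≤ Real.exp (L / 8) * (8 * Real.exp (L / 8)) :=
    mul_le_mul hQexp hL8 (by linarith) (Real.exp_pos _).le
  nlinarith [Real.exp_pos (L / 8)]

/-- The left-line integral for `ζ_K`: with the constant `Al` of
`exists_norm_logDeriv_classGroupLFunction_left_le` and the smooth-transition bound `M`,
`‖J₁(0)‖ ≤ 8 · leftLineConst · Al (n + 1) M` for `g = tzTest L ε`, `ε = e^{−νL}`, `0 < ν ≤ 1/64`,
`Q ≤ e^{L/8}`, `0 < ε < L/2`, `ε ≤ 1`. -/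
theorem leftLine_term_le_one {Al : ℝ} (hAl0 : 0 < Al)
    (hAl : ∀ (K : Type) [Field K] [NumberField K] (χ : ClassGroup (𝓞 K) →* ℂˣ) (t : ℝ),
      ‖logDeriv (classGroupLFunction K χ) (-1 / 2 + t * I)‖ ≤
        Al * (Module.finrank ℚ K + 1) * (Real.log ((NumberField.discr K).natAbs : ℝ) + Real.log (|t| + 4)))
    {M : ℝ} (hM : ∀ y : ℝ, |iteratedDeriv 1 Real.smoothTransition y| ≤ M ∧
      |iteratedDeriv 2 Real.smoothTransition y| ≤ M)
    (K : Type) [Field K] [NumberField K] (hK : 1 < Module.finrank ℚ K)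
    {L ε ν : ℝ} (hL : 0 < L) (hε : 0 < ε) (hεL : ε < L / 2)
    (hε1 : ε ≤ 1) (hν64 : ν ≤ 1 / 64) (hεexp : ε = Real.exp (-(ν * L)))
    (hQexp : ThornerZaman.condQn K ≤ Real.exp (L / 8)) :
    ‖dzEFRemainder K (tzTest L ε) 0‖ ≤ 8 * leftLineConst * Al * (Module.finrank ℚ K + 1) * M := by
  have hJ := norm_dzEFRemainder_tzTest_zero_le (K := K) hAl0 hAl hM hL hε hεL
  have hM0 : 0 ≤ M := le_trans (abs_nonneg _) (hM 0).1
  have hlC := leftLineConst_nonneg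
  set Q := ThornerZaman.condQn K with hQ
  have hQ12 : (12 : ℝ) ≤ Q := ThornerZaman.twelve_le_condQn (K := K) hK
  obtain ⟨hlogd0, hlogd⟩ := log_natAbs_discr_mem K
  have hlogd4 : Real.log ((NumberField.discr K).natAbs : ℝ) + Real.log 4 + 1 ≤ 2 * Q := by
    have hlog4 : Real.log 4 ≤ 2 := by
      have : Real.log 4 = 2 * Real.log 2 := by
        rw [show (4:ℝ) = 2 ^ 2 by norm_num, Real.log_pow]; norm_num
      rw [this]; have := Real.log_two_lt_d9; linarith
    rw [← hQ] at hlogd; linarith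
  have hexp1 : Real.exp (-(L / 4) + ε / 2) ≤ 2 * Real.exp (-(L / 4)) := by
    rw [Real.exp_add, mul_comm]
    refine mul_le_mul_of_nonneg_right ?_ (Real.exp_pos _).le
    have hsq : Real.exp (ε / 2) ^ 2 < 2 ^ 2 := by
      rw [← Real.exp_nat_mul]
      have h1 : Real.exp ((2 : ℕ) * (ε / 2)) ≤ Real.exp 1 := Real.exp_le_exp.2 (by push_cast; linarith)
      have := Real.exp_one_lt_d9; linarith
    exact (lt_of_pow_lt_pow_left₀ 2 (by norm_num) hsq).le
  have hexp2 : 2 * M / ε ≤ 2 * M * Real.exp (L / 64) := by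
    rw [hεexp, div_eq_mul_inv, ← Real.exp_neg, neg_neg]
    refine mul_le_mul_of_nonneg_left (Real.exp_le_exp.2 ?_) (by positivity)
    nlinarith
  have hlog40 : 0 ≤ Real.log 4 := Real.log_nonneg (by norm_num)
  have hprod : (Real.log ((NumberField.discr K).natAbs : ℝ) + Real.log 4 + 1) *
      (Real.exp (-(L / 4) + ε / 2) * (2 * M / ε)) ≤ 8 * M := by
    calc (Real.log ((NumberField.discr K).natAbs : ℝ) + Real.log 4 + 1) *
          (Real.exp (-(L / 4) + ε / 2) * (2 * M / ε))
        ≤ (2 * Q) * ((2 * Real.exp (-(L / 4))) * (2 * M * Real.exp (L / 64))) :=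
          mul_le_mul hlogd4 (mul_le_mul hexp1 hexp2 (by positivity) (by positivity))
            (by positivity) (by positivity)
      _ ≤ (2 * Real.exp (L / 8)) * ((2 * Real.exp (-(L / 4))) * (2 * M * Real.exp (L / 64))) :=
          mul_le_mul_of_nonneg_right (by linarith) (by positivity)
      _ = 8 * M * Real.exp (L / 8 + -(L / 4) + L / 64) := by
          rw [Real.exp_add, Real.exp_add]; ring
      _ ≤ 8 * M * 1 := by
          refine mul_le_mul_of_nonneg_left ?_ (by positivity)
          rw [Real.exp_le_one_iff]; nlinarith
      _ = 8 * M := mul_one _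
  refine hJ.trans ?_
  rw [mul_assoc (leftLineConst * (Al * ((Module.finrank ℚ K : ℝ) + 1)))]
  calc leftLineConst * (Al * ((Module.finrank ℚ K : ℝ) + 1)) *
        ((Real.log ((NumberField.discr K).natAbs : ℝ) + Real.log 4 + 1) *
          (Real.exp (-(L / 4) + ε / 2) * (2 * M / ε)))
      ≤ leftLineConst * (Al * ((Module.finrank ℚ K : ℝ) + 1)) * (8 * M) :=
        mul_le_mul_of_nonneg_left hprod (by positivity)
    _ = _ := by ring

/-! ### Numerics -/

/-- `e^4 ≥ 54`. -/
theorem exp_four_ge : (54 : ℝ) ≤ Real.exp 4 := by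
  have h := Real.exp_one_gt_d9
  have h4 : Real.exp 4 = Real.exp 1 ^ 4 := by
    rw [← Real.exp_nat_mul]; norm_num
  rw [h4]
  have h0 : (0 : ℝ) ≤ 2.7182818283 := by norm_num
  have := pow_le_pow_left₀ h0 h.le 4
  nlinarith

/-- `e^6 ≥ 400`. -/
theorem exp_six_ge : (400 : ℝ) ≤ Real.exp 6 := by
  have h := Real.exp_one_gt_d9
  have h6 : Real.exp 6 = Real.exp 1 ^ 6 := by
    rw [← Real.exp_nat_mul]; norm_num
  rw [h6]
  have h0 : (0 : ℝ) ≤ 2.7182818283 := by norm_num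
  have := pow_le_pow_left₀ h0 h.le 6
  nlinarith

/-- **The exceptional term is at most `x/50`**: for `15/16 ≤ β` and `4 ≤ (1 − β) L`,
`∫_{L/2}^{L} e^{βu} du ≤ e^L/50`. -/
theorem integral_exp_mul_le_div {β L : ℝ} (hβ : 15 / 16 ≤ β) (h4 : 4 ≤ (1 - β) * L) :
    ∫ u in (L / 2)..L, Real.exp (β * u) ≤ Real.exp L / 50 := by
  have hβ0 : 0 < β := by linarith
  rw [TZWeight.integral_exp_mul hβ0.ne']
  have h1 : Real.exp (β * L) ≤ Real.exp L * Real.exp (-4) := by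
    rw [← Real.exp_add]; exact Real.exp_le_exp.2 (by nlinarith)
  have h2 : 0 < Real.exp (β * (L / 2)) := Real.exp_pos _
  have he4 : Real.exp (-4) ≤ 1 / 54 := by
    rw [Real.exp_neg, ← one_div]
    exact one_div_le_one_div_of_le (by norm_num) exp_four_ge
  rw [div_le_iff₀ hβ0]
  have hx0 : 0 < Real.exp L := Real.exp_pos _
  have h3 : Real.exp L * Real.exp (-4) ≤ Real.exp L * (1 / 54) := mul_le_mul_of_nonneg_left he4 hx0.le
  nlinarith

end Summit.QuantumAdvantage.QuantumAdvantage.Theorems.DegreeOnePrimesEscape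

end
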